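import Summits.KontsevichZagierPeriods.KontsevichZagierPeriods.Theorems.OctahedralSymmetryOctahedralSpanAllWeightsBinaryInterior
import HarnessLib

/-!
# Crux `OctahedralSpanAllWeights` (stmt-KontsevichZagierPeriods-9659), line `Sketch`, block E:
# family alpha — the words `Z 0 4^k 0` with a fresh unit letter die by ONE finite double shuffle

**Theorem `stub_elim_end_alpha` (all weights).** Let `W = Z ++ [0] ++ 4^k ++ [0]` (`k ≥ 1`) be a
convergent level-4 word (letters `Fin 5`: `0` = pole `1`, `4` = pole `0`, `1, 2, 3` = the unit poles
`i, -1, -i`) and let `u ∈ {1, 2, 3}` be a unit letter NOT occurring in `Z`.  Then `[W]` lies in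
`rel ⊔ span{[V]}`, `V` convergent of the same length with fewer letters `0`, or with as many letters
`0` and fewer letters `4` (the lexicographic target of block E of the skeleton v6, lead c3).

**Mechanism (one generator).**  Write `Z ++ [0] = word lZ` (`exists_idx`; the total exponent of `lZ`
is `0` as its last pole is `1`), `l := lZ ++ [(k, -u)]` (word `Z 0 4^{k-1} u`) and take the one-part
index `[(1, u)]` (word `[-u]`).  Every term of the stuffle `l ∗ [(1,u)]` (Zhao 2010, Def. 2.4) INSERTS
the part `(1,u)` into `l` or MERGES it into one part (`mem_stuffleIdx_singleton`); behind that point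
every pole is multiplied by `i^{-u}`, which on letters fixes `4`, sends `0 ↦ -u ≠ 0` and `u ↦ 0`
(`count_zero_wordAux_add`).  The merge into the LAST part is `lZ ++ [(k+1, 0)]`, of word `W`; as `u`
is fresh, every other term has at most `#0(W)` letters `0` — the insertions with `#4(W) - 1` letters
`4`, the earlier merges with fewer letters `0` (they lose the `0` closing `Z 0`) — and the shuffle
terms `word l ш [-u]` have `#0(W) - 1` letters `0`.  `RegularE0.fds_top` (top terms of
`fds(l, [(1,u)]) ∈ rel`) and the isolation of `[W]` among the merges conclude.  Checked beforehand by
exact computation for all such words of length `≤ 7` (lead c3's lab, family alpha).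

Sources: J. Zhao, *Standard relations of multiple polylogarithm values at roots of unity*, Doc. Math.
15 (2010), §2 (words of indices), Def. 2.4 (stuffle), (FDS) [Zhao2010]; M. E. Hoffman, J. Algebra 194
(1997), §2 (quasi-shuffle recursion) [Hoffman1997].  The bookkeeping is folklore.
-/
noncomputable section

namespace Summit.KontsevichZagierPeriods.OctahedralSymmetry.OctaSpan

open Literature.NumberTheory.Transcendental Literature.NumberTheory.Transcendental.LevelFour

namespace ElimAlpha

/-! ## Words of indices: concatenation, pole shift, last pole, existence of an index -/

/-- **The word of a concatenated index**: the second factor is read from the accumulated exponent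
`acc + e₁ + ⋯ + e_d` of the first. [cite: Zhao2010, §2] -/
theorem wordAux_append : ∀ (acc : Fin 4) (l₁ l₂ : List (ℕ × Fin 4)),
    wordAux acc (l₁ ++ l₂) = wordAux acc l₁ ++ wordAux (acc + (l₁.map Prod.snd).sum) l₂
  | acc, [], l₂ => by simp [wordAux]
  | acc, q :: l₁, l₂ => by
    rw [List.cons_append, wordAux, wordAux, wordAux_append (acc + q.2) l₁ l₂, List.map_cons,
      List.sum_cons, add_assoc]
    simp only [List.append_assoc]

/-- The word of a one-part index. [folklore] -/
theorem wordAux_single (acc : Fin 4) (s : ℕ) (e : Fin 4) :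
    wordAux acc [(s, e)] = List.replicate (s - 1) 4 ++ [Fin.castSucc (-(acc + e))] := by
  simp [wordAux]

/-- **Pole shift.** Reading an index from `a + e` instead of `a` multiplies every pole by `i^{-e}`, so
the letters `0` (pole `1`) of the shifted word sit exactly at the letters `castSucc e` (pole `i^e`) of
the original one: `#0 (wordAux (a + e) l) = #(castSucc e) (wordAux a l)`. [folklore] -/
theorem count_zero_wordAux_add : ∀ (a e : Fin 4) (l : List (ℕ × Fin 4)),
    (wordAux (a + e) l).count 0 = (wordAux a l).count (Fin.castSucc e)
  | _, _, [] => rfl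
  | a, e, q :: l => by
    have h4 : ∀ x : Fin 4, (4 : Fin 5) ≠ Fin.castSucc x := by decide
    have key : ∀ y e : Fin 4, Fin.castSucc (-(y + e)) = (0 : Fin 5) ↔
        Fin.castSucc (-y) = Fin.castSucc e := by decide
    simp only [wordAux, List.count_append, List.count_singleton', add_right_comm a e q.2, key,
      count_zero_wordAux_add (a + q.2) e l, List.count_replicate, beq_iff_eq, if_neg (h4 e),
      if_neg (show (4 : Fin 5) ≠ 0 by decide)]

/-- The last letter of the word of a nonempty index read from `acc` is the pole letter
`castSucc (-(acc + e₁ + ⋯ + e_d))`. [folklore] -/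
theorem getLast?_wordAux_eq : ∀ (acc : Fin 4) {l : List (ℕ × Fin 4)}, l ≠ [] →
    (wordAux acc l).getLast? = some (Fin.castSucc (-(acc + (l.map Prod.snd).sum)))
  | _, [], h => (h rfl).elim
  | acc, q :: l, _ => by
    by_cases hl : l = []
    · subst hl; simp [wordAux]
    · rw [wordAux, List.getLast?_append, getLast?_wordAux_eq (acc + q.2) hl, List.map_cons,
        List.sum_cons, add_assoc]; rfl

/-- **Every word not ending in the letter `4` is the word of an index with positive parts**, read from
any accumulated exponent (peel letters from the left: a `4` lengthens the first part, a pole letter `c`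
is a part `(1, ·)` followed by the index of the tail read from `-c`). [cite: Zhao2010, §2] -/
theorem exists_idx : ∀ (V : List (Fin 5)), V.getLast? ≠ some 4 → ∀ acc : Fin 4,
    ∃ l : List (ℕ × Fin 4), wordAux acc l = V ∧ ∀ p ∈ l, 1 ≤ p.1
  | [], _, _ => ⟨[], rfl, by simp⟩
  | a :: V, hV, acc => by
    have hV' : V.getLast? ≠ some 4 := by
      cases V with | nil => simp | cons b V => rwa [List.getLast?_cons_cons] at hV
    by_cases ha : a = 4
    · subst ha
      obtain ⟨l, hl, hpos⟩ := exists_idx V hV' acc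
      cases l with
      | nil => exact absurd hl (by rintro rfl; exact hV rfl)
      | cons q l =>
        obtain ⟨s, hs⟩ : ∃ s : ℕ, q.1 = s + 1 := ⟨q.1 - 1, by have := hpos q (by simp); omega⟩
        refine ⟨(q.1 + 1, q.2) :: l, ?_, fun p hp => ?_⟩
        · rw [← hl, wordAux, wordAux, hs, Nat.add_sub_cancel, Nat.add_sub_cancel,
            List.replicate_succ]; rfl
        · rcases List.mem_cons.1 hp with rfl | hp
          exacts [Nat.succ_pos _, hpos p (List.mem_cons_of_mem _ hp)]
    · obtain ⟨c, rfl⟩ := Fin.exists_castSucc_eq.2 ha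
      obtain ⟨l, hl, hpos⟩ := exists_idx V hV' (-c)
      refine ⟨(1, -c - acc) :: l, ?_, fun p hp => ?_⟩
      · rw [wordAux, show acc + (-c - acc) = -c by abel, hl]; simp
      · rcases List.mem_cons.1 hp with rfl | hp
        exacts [le_rfl, hpos p hp]

/-- A nonempty right factor of a word ending in the letter `0` contains the letter `0`. [folklore] -/
theorem zero_mem_of_append_eq {l₁ l₂ Z : List (Fin 5)} (h : l₁ ++ l₂ = Z ++ [0]) (hne : l₂ ≠ []) :
    (0 : Fin 5) ∈ l₂ := by
  rcases List.eq_nil_or_concat' l₂ with rfl | ⟨l₂', y, rfl⟩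
  · exact (hne rfl).elim
  · rw [← List.append_assoc] at h
    obtain rfl : y = 0 := by simpa using (List.append_inj' h rfl).2
    simp

/-! ## Stuffle with a one-part index: insertions and merges -/

/-- **Stuffle with a one-part index** (Zhao 2010, Def. 2.4, second factor of depth one): every term of
`l ∗ [p]` either inserts the part `p` into `l` or merges it (componentwise sum) into one part of `l`.
[cite: Zhao2010, §2 Def. 2.4] -/
theorem mem_stuffleIdx_singleton (p : ℕ × Fin 4) : ∀ (l j : List (ℕ × Fin 4)),
    j ∈ stuffleIdx l [p] →
      (∃ l₁ l₂ : List (ℕ × Fin 4), l₁ ++ l₂ = l ∧ j = l₁ ++ p :: l₂) ∨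
        (∃ (l₁ : List (ℕ × Fin 4)) (q : ℕ × Fin 4) (l₂ : List (ℕ × Fin 4)),
          l₁ ++ q :: l₂ = l ∧ j = l₁ ++ (q.1 + p.1, q.2 + p.2) :: l₂)
  | [], j, hj => Or.inl ⟨[], [], rfl, by simpa using hj⟩
  | q :: l, j, hj => by
    rw [stuffleIdx_cons_cons, stuffleIdx_nil_right, stuffleIdx_nil_right, List.map_singleton,
      List.map_singleton, List.mem_append, List.mem_append, List.mem_map, List.mem_singleton,
      List.mem_singleton] at hj
    rcases hj with ⟨j', hj', rfl⟩ | rfl | rfl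
    · rcases mem_stuffleIdx_singleton p l j' hj' with
        ⟨l₁, l₂, rfl, rfl⟩ | ⟨l₁, q', l₂, rfl, rfl⟩
      · exact Or.inl ⟨q :: l₁, l₂, rfl, rfl⟩
      · exact Or.inr ⟨q :: l₁, q', l₂, rfl, rfl⟩
    · exact Or.inl ⟨[], q :: l, rfl, rfl⟩
    · exact Or.inr ⟨[], q, l, rfl, rfl⟩

/-- The merge of `p` into the LAST part of `l ++ [r]` is a term of `(l ++ [r]) ∗ [p]`. [folklore] -/
theorem concat_merge_mem_stuffleIdx (p r : ℕ × Fin 4) : ∀ (l : List (ℕ × Fin 4)),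
    l ++ [(r.1 + p.1, r.2 + p.2)] ∈ stuffleIdx (l ++ [r]) [p]
  | [] => by simp
  | q :: l => by
    rw [List.cons_append, List.cons_append, stuffleIdx_cons_cons, List.mem_append]
    exact Or.inl (List.mem_map.2 ⟨_, concat_merge_mem_stuffleIdx p r l, rfl⟩)

/-- **Stuffle terms of convergent indices are convergent indices**: parts stay `≥ 1`
(`RegularE0.stuffle_wt`) and the first part of a term is the first part of a factor or their merge
(weight `≥ 2`). [folklore] -/
theorem isConvergentIdx_of_mem_stuffleIdx {k l j : List (ℕ × Fin 4)} (hk : IsConvergentIdx k)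
    (hl : IsConvergentIdx l) (hj : j ∈ stuffleIdx k l) : IsConvergentIdx j := by
  refine ⟨(RegularE0.stuffle_wt k l j hj).2.2 hk.1 hl.1, ?_⟩
  cases k with
  | nil => rw [stuffleIdx_nil_left, List.mem_singleton] at hj; exact hj ▸ hl.2
  | cons p k =>
    cases l with
    | nil => rw [stuffleIdx_nil_right, List.mem_singleton] at hj; exact hj ▸ hk.2
    | cons q l =>
      rw [stuffleIdx_cons_cons, List.mem_append, List.mem_append, List.mem_map, List.mem_map,
        List.mem_map] at hj
      intro x hx
      rcases hj with ⟨j, -, rfl⟩ | ⟨j, -, rfl⟩ | ⟨j, -, rfl⟩ <;>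
        simp only [List.head?_cons, Option.mem_def, Option.some.injEq] at hx <;> subst hx
      · exact hk.2 p (by simp)
      · exact hl.2 q (by simp)
      · have := hk.1 p (by simp); have := hl.1 q (by simp)
        simp only [ne_eq, Prod.mk.injEq, not_and]; omega

/-! ## Family alpha -/

/-- **Family alpha on indices.** For an index `lZ` with `word lZ = Z ++ [0]`, `k ≥ 1` and an exponent
`u ≠ 0` whose letter does not occur in `Z`, the convergent word `W = Z 0 4^k 0` lies in `rel ⊔ span{[V]}`,
`V` convergent of length `|W|` with `(#0, #4)(V) <_lex (#0, #4)(W)`: the finite double shuffle of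
`l = lZ ++ [(k, -u)]` with `[(1, u)]` has `W` as its merge into the last part, all other terms lower.
[cite: Zhao2010, §2 Def. 2.4] -/
theorem alpha_core (lZ : List (ℕ × Fin 4)) (Z : List (Fin 5)) (hlZ : wordAux 0 lZ = Z ++ [0])
    (hpos : ∀ p ∈ lZ, 1 ≤ p.1) (k : ℕ) (hk : 1 ≤ k) (u : Fin 4) (hu : u ≠ 0)
    (huZ : Fin.castSucc u ∉ Z) (hW : IsConvergent (Z ++ 0 :: (List.replicate k 4 ++ [0]))) :
    sym (Z ++ 0 :: (List.replicate k 4 ++ [0])) ∈ rel ⊔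
      Submodule.span ℚ (sym '' {V | V.length = (Z ++ 0 :: (List.replicate k 4 ++ [0])).length ∧
        IsConvergent V ∧ (V.count 0 < (Z ++ 0 :: (List.replicate k 4 ++ [0])).count 0 ∨
          (V.count 0 = (Z ++ 0 :: (List.replicate k 4 ++ [0])).count 0 ∧
            V.count 4 < (Z ++ 0 :: (List.replicate k 4 ++ [0])).count 4))}) := by
  have hc4 : ∀ x : Fin 4, Fin.castSucc x ≠ (4 : Fin 5) := by decide
  have hc0 : ∀ x : Fin 4, Fin.castSucc x = (0 : Fin 5) ↔ x = 0 := by decide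
  have h40 : (4 : Fin 5) ≠ 0 := by decide
  have hu0 : Fin.castSucc u ≠ (0 : Fin 5) := fun h => hu ((hc0 u).1 h)
  have hnu0 : Fin.castSucc (-u) ≠ (0 : Fin 5) := fun h => hu (neg_eq_zero.1 ((hc0 _).1 h))
  have huZ0 : Fin.castSucc u ∉ Z ++ [0] := by simp [huZ, hu0]
  -- the word `W` and its numerics
  set W := Z ++ 0 :: (List.replicate k 4 ++ [0]) with hWdef
  have hW0 : W.count 0 = Z.count 0 + 2 := by simp [hWdef, List.count_replicate]
  have hW4 : W.count 4 = Z.count 4 + k := by simp [hWdef, h40.symm]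
  have hWl : W.length = Z.length + k + 2 := by simp [hWdef]; omega
  -- the index `lZ = q₀ :: t₀`: total exponent `0`, convergent first part
  have hlZne : lZ ≠ [] := by rintro rfl; simp [wordAux] at hlZ
  have hE : (lZ.map Prod.snd).sum = 0 := by
    have h := getLast?_wordAux_eq 0 hlZne
    rw [hlZ, zero_add, List.getLast?_append, List.getLast?_singleton, Option.some_or,
      Option.some.injEq] at h
    exact neg_eq_zero.1 ((hc0 _).1 h.symm)
  obtain ⟨q₀, t₀, rfl⟩ := List.exists_cons_of_ne_nil hlZne
  have hq₀ : q₀ ≠ (1, 0) := by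
    rintro rfl
    have h := head?_wordAux 0 ((1 : ℕ), (0 : Fin 4)) t₀
    rw [hlZ] at h
    have hZ0 : (Z ++ [0]).head? ≠ some 0 := by
      cases Z with | nil => exact absurd rfl hW.1 | cons z Z' => exact hW.1
    exact hZ0 (by rw [h]; simp)
  -- the indices `l = lZ ++ [(k, -u)]`, `[(1, u)]`, and the distinguished merge `m₀`
  set r : ℕ × Fin 4 := (k, -u) with hr
  set l : List (ℕ × Fin 4) := (q₀ :: t₀) ++ [r] with hl
  set m₀ : List (ℕ × Fin 4) := (q₀ :: t₀) ++ [(k + 1, -u + u)] with hm₀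
  have hlpos : ∀ p ∈ l, 1 ≤ p.1 := fun p hp => by
    rcases List.mem_append.1 hp with hp | hp
    exacts [hpos p hp, (List.mem_singleton.1 hp).symm ▸ hk]
  have hlconv : IsConvergentIdx l := ⟨hlpos, fun x hx => by
    rw [hl, List.cons_append, List.head?_cons, Option.mem_def, Option.some.injEq] at hx
    exact hx ▸ hq₀⟩
  have hpconv : IsConvergentIdx [((1 : ℕ), u)] :=
    RegularE0.isConvergentIdx_cons le_rfl (fun _ => hu) (by simp)
  have hwl : word l = Z ++ [0] ++ (List.replicate (k - 1) 4 ++ [Fin.castSucc u]) := by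
    rw [word, hl, wordAux_append, hlZ, hE, zero_add, hr, wordAux_single]; simp
  have hwp : word [((1 : ℕ), u)] = [Fin.castSucc (-u)] := by simp [word, wordAux]
  have hwm₀ : word m₀ = W := by
    rw [word, hm₀, wordAux_append, hlZ, hE, zero_add, wordAux_single, hWdef]; simp
  have hm₀S : m₀ ∈ stuffleIdx l [((1 : ℕ), u)] :=
    concat_merge_mem_stuffleIdx (1, u) r (q₀ :: t₀)
  have hm₀len : m₀.length = l.length := by simp [hm₀, hl]
  set T : Submodule ℚ WordQ := Submodule.span ℚ (sym '' {V | V.length = W.length ∧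
    IsConvergent V ∧ (V.count 0 < W.count 0 ∨ (V.count 0 = W.count 0 ∧ V.count 4 < W.count 4))})
  have hgood₁ : ∀ V : List (Fin 5), V.length = W.length → IsConvergent V → V.count 0 < W.count 0 →
      sym V ∈ T := fun V h1 h2 h3 => Submodule.subset_span ⟨V, ⟨h1, h2, Or.inl h3⟩, rfl⟩
  have hgood₂ : ∀ V : List (Fin 5), V.length = W.length → IsConvergent V → V.count 0 ≤ W.count 0 →
      V.count 4 < W.count 4 → sym V ∈ T := fun V h1 h2 h3 h4 =>
    Submodule.subset_span ⟨V, ⟨h1, h2, h3.lt_or_eq.imp_right fun h => ⟨h, h4⟩⟩, rfl⟩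
  -- every stuffle term other than `m₀` is lower
  have hcore : ∀ j ∈ stuffleIdx l [((1 : ℕ), u)], j = m₀ ∨ sym (word j) ∈ T := by
    intro j hj
    have hjconv : IsConvergent (word j) :=
      isConvergent_word (isConvergentIdx_of_mem_stuffleIdx hlconv hpconv hj)
    rcases mem_stuffleIdx_singleton (1, u) l j hj with
      ⟨l₁, l₂, hl₁₂, rfl⟩ | ⟨l₁, q, l₂, hl₁₂, rfl⟩
    · -- insertion of the part `(1, u)`
      right
      rcases List.eq_nil_or_concat' l₂ with rfl | ⟨a, x, rfl⟩
      · -- at the very end: the word is `word l ++ [0]`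
        obtain rfl : l₁ = l := by simpa using hl₁₂
        have hwj : word (l ++ [((1 : ℕ), u)]) =
            Z ++ [0] ++ (List.replicate (k - 1) 4 ++ [Fin.castSucc u]) ++ [0] := by
          rw [word, wordAux_append, ← word, hwl, hl, List.map_append, List.sum_append, hE,
            zero_add, wordAux_single, hr]; simp
        refine hgood₂ _ ?_ hjconv ?_ ?_
        · rw [hwj, hWl]; simp; omega
        · rw [hwj, hW0]; simp [List.count_replicate, hu0]
        · rw [hwj, hW4]; simp [hc4 u]; omega
      · -- inside: `q₀ :: t₀ = l₁ ++ a`, `x = (k, -u)`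
        rw [← List.append_assoc, hl] at hl₁₂
        obtain ⟨h1, h2⟩ := List.append_inj' hl₁₂ rfl
        obtain rfl : x = r := by simpa using h2
        rw [← h1, wordAux_append, zero_add] at hlZ
        rw [← h1, List.map_append, List.sum_append] at hE
        set E₁ := (l₁.map Prod.snd).sum with hE₁
        have hx : E₁ + u + (a.map Prod.snd).sum + -u = 0 := by rw [← hE]; abel
        have hwj : word (l₁ ++ (1, u) :: (a ++ [r])) = wordAux 0 l₁ ++
            Fin.castSucc (-(E₁ + u)) :: (wordAux (E₁ + u) a ++ (List.replicate (k - 1) 4 ++ [0])) := by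
          rw [word, wordAux_append, zero_add, wordAux, wordAux_append, ← hE₁]
          dsimp only
          rw [hr, wordAux_single, hx]; simp
        have hB0 : (wordAux (E₁ + u) a).count 0 = 0 := by
          rw [count_zero_wordAux_add]
          exact List.count_eq_zero.2 fun h => huZ0 (hlZ ▸ List.mem_append_right _ h)
        have ha1 : ∀ p ∈ a, 1 ≤ p.1 := fun p hp => hpos p (h1 ▸ List.mem_append_right l₁ hp)
        have hB4 := RegularE0.count_four_wordAux (E₁ + u) a ha1
        have hB4' := RegularE0.count_four_wordAux E₁ a ha1
        have hBl : (wordAux (E₁ + u) a).length = (wordAux E₁ a).length := by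
          rw [length_wordAux _ _ ha1, length_wordAux _ _ ha1]
        have hx0 : Fin.castSucc (-(E₁ + u)) ≠ 0 := by
          intro hz
          have hu' : u = -E₁ := eq_neg_of_add_eq_zero_right (neg_eq_zero.1 ((hc0 _).1 hz))
          by_cases hl₁ : l₁ = []
          · subst hl₁; exact hu (by simpa [hE₁] using hu')
          · have hm := List.mem_of_getLast? (getLast?_wordAux_eq 0 hl₁)
            rw [zero_add, ← hE₁, ← hu'] at hm
            exact huZ0 (hlZ ▸ List.mem_append_left _ hm)
        have hn := congrArg List.length hlZ
        have h0 := congrArg (List.count 0) hlZ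
        have h4 := congrArg (List.count 4) hlZ
        simp only [List.length_append, List.length_singleton, List.count_append,
          List.count_singleton', ite_true, if_neg h40.symm] at hn h0 h4
        have hc4c := hc4 (-(E₁ + u))
        set c := Fin.castSucc (-(E₁ + u))
        refine hgood₂ _ ?_ hjconv ?_ ?_
        · rw [hwj, hWl]; simp only [List.length_append, List.length_cons, List.length_replicate,
            List.length_nil]; omega
        · rw [hwj, hW0]; simp [List.count_replicate, hB0, hx0]; omega
        · rw [hwj, hW4]; simp [hc4c]; omega
    · -- merge of the part `(1, u)` into the part `q`
      rcases List.eq_nil_or_concat' l₂ with rfl | ⟨a, x, rfl⟩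
      · -- into the last part: this is `m₀`
        left
        rw [hl] at hl₁₂
        obtain ⟨h1, h2⟩ := List.append_inj' hl₁₂ rfl
        obtain rfl : q = r := by simpa using h2
        rw [h1, hm₀, hr]
      · -- into an earlier part: `q₀ :: t₀ = l₁ ++ q :: a`, `x = (k, -u)`
        right
        have hl₁₂' : (l₁ ++ q :: a) ++ [x] = (q₀ :: t₀) ++ [r] := by rw [← hl, ← hl₁₂]; simp
        obtain ⟨h1, h2⟩ := List.append_inj' hl₁₂' rfl
        obtain rfl : x = r := by simpa using h2
        have hq1 : 1 ≤ q.1 := hpos q (by rw [← h1]; simp)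
        rw [← h1, wordAux_append, zero_add, wordAux] at hlZ
        rw [← h1, List.map_append, List.sum_append, List.map_cons, List.sum_cons] at hE
        set E₁ := (l₁.map Prod.snd).sum with hE₁
        have hx : E₁ + (q.2 + u) + (a.map Prod.snd).sum + -u = 0 := by rw [← hE]; abel
        have hwj : word (l₁ ++ (q.1 + 1, q.2 + u) :: (a ++ [r])) = wordAux 0 l₁ ++
            (List.replicate q.1 4 ++ Fin.castSucc (-(E₁ + (q.2 + u))) ::
              (wordAux (E₁ + (q.2 + u)) a ++ (List.replicate (k - 1) 4 ++ [0]))) := by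
          rw [word, wordAux_append, zero_add, wordAux, wordAux_append, ← hE₁]
          dsimp only
          rw [hr, wordAux_single, hx, Nat.add_sub_cancel]; simp
        have hlZ' : (wordAux 0 l₁ ++ List.replicate (q.1 - 1) 4) ++
            (Fin.castSucc (-(E₁ + q.2)) :: wordAux (E₁ + q.2) a) = Z ++ [0] := by
          rw [← hlZ]; simp
        have hB0 : (wordAux (E₁ + (q.2 + u)) a).count 0 = 0 := by
          rw [← add_assoc, count_zero_wordAux_add]
          exact List.count_eq_zero.2 fun h =>
            huZ0 (hlZ' ▸ List.mem_append_right _ (List.mem_cons_of_mem _ h))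
        have ha1 : ∀ p ∈ a, 1 ≤ p.1 := fun p hp =>
          hpos p (h1 ▸ List.mem_append_right l₁ (List.mem_cons_of_mem q hp))
        have hBl : (wordAux (E₁ + (q.2 + u)) a).length = (wordAux (E₁ + q.2) a).length := by
          rw [length_wordAux _ _ ha1, length_wordAux _ _ ha1]
        have hx0 : Fin.castSucc (-(E₁ + (q.2 + u))) ≠ 0 := by
          intro hz
          rw [← add_assoc] at hz
          have hu' : u = -(E₁ + q.2) := eq_neg_of_add_eq_zero_right (neg_eq_zero.1 ((hc0 _).1 hz))
          exact huZ0 (hlZ' ▸ List.mem_append_right _ (hu' ▸ List.mem_cons_self))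
        have htail : 1 ≤ (Fin.castSucc (-(E₁ + q.2)) :: wordAux (E₁ + q.2) a).count 0 :=
          List.count_pos_iff.2 (zero_mem_of_append_eq hlZ' (List.cons_ne_nil _ _))
        have hn := congrArg List.length hlZ'
        have h0 := congrArg (List.count 0) hlZ'
        simp only [List.length_append, List.length_cons, List.length_nil, List.length_replicate,
          List.count_append, List.count_singleton', ite_true, List.count_replicate, beq_iff_eq,
          if_neg h40] at hn h0
        set c' := Fin.castSucc (-(E₁ + (q.2 + u)))
        refine hgood₁ _ ?_ hjconv ?_
        · rw [hwj, hWl]; simp only [List.length_append, List.length_cons, List.length_replicate,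
            List.length_nil]; omega
        · rw [hwj, hW0]; simp [List.count_replicate, hB0, hx0]; omega
  -- the shuffle terms are lower
  have hsh : toQ (shuffle (word l) (word [((1 : ℕ), u)])) ∈ T := by
    refine RegularE0.toQ_shuffle_mem _ _ _ fun w hw => ?_
    have hperm := MZV.perm_of_mem_shuffleWord _ _ hw
    refine hgood₁ w ?_ (isConvergent_of_mem_shuffleWord (isConvergent_word hlconv)
      (isConvergent_word hpconv) hw) ?_
    · rw [hperm.length_eq, List.length_append, hwl, hwp, hWl]; simp; omega
    · rw [hperm.count_eq, List.count_append, hwl, hwp, hW0]; simp [List.count_replicate, hu0, hnu0]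
  -- top extraction from `fds(l, [(1, u)]) ∈ rel` and isolation of `[W]` among the merges
  have htop := RegularE0.fds_top hlconv hpconv T (fun j hj hjl => ?_) hsh
  · have hWL : W ∈ ((stuffleIdx l [((1 : ℕ), u)]).filter fun j => j.length = l.length).map word :=
      List.mem_map.2 ⟨m₀, List.mem_filter.2 ⟨hm₀S, by simpa using hm₀len⟩, hwm₀⟩
    refine RegularE0.sym_mem_of_sum_mem (rel ⊔ T) _ W hWL (by rw [List.map_map]; exact htop)
      fun w hw hne => ?_
    obtain ⟨j, hj, rfl⟩ := List.mem_map.1 hw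
    rcases hcore j (List.mem_filter.1 hj).1 with rfl | h
    · exact absurd hwm₀ hne
    · exact Submodule.mem_sup_right h
  · rcases hcore j hj with rfl | h
    · exact absurd hm₀len hjl
    · exact h

end ElimAlpha

/-- **Stub E-alpha (all weights).** A convergent word `W = Z 0 4^k 0` (`k ≥ 1`) such that some unit
letter `u ∈ {1,2,3}` does NOT occur in `Z` reduces, modulo `rel`, to convergent words of the same length
with fewer letters `0`, or with as many letters `0` and fewer letters `4`: one finite double shuffle,
that of `l` (`word l = Z 0 4^{k-1} u`) with `[(1,u)]`, whose merge into the last part is `W` and whose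
other terms are lower (`ElimAlpha.alpha_core`). [cite: Zhao2010, §2 Def. 2.4] -/
theorem stub_elim_end_alpha (Z : List (Fin 5)) (k : ℕ) (hk : 1 ≤ k) (u : Fin 5)
    (hu : u = 1 ∨ u = 2 ∨ u = 3) (huZ : u ∉ Z)
    (hW : IsConvergent (Z ++ 0 :: (List.replicate k 4 ++ [0]))) :
    sym (Z ++ 0 :: (List.replicate k 4 ++ [0])) ∈ rel ⊔
      Submodule.span ℚ (sym '' {V | V.length = (Z ++ 0 :: (List.replicate k 4 ++ [0])).length ∧
        IsConvergent V ∧ (V.count 0 < (Z ++ 0 :: (List.replicate k 4 ++ [0])).count 0 ∨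
          (V.count 0 = (Z ++ 0 :: (List.replicate k 4 ++ [0])).count 0 ∧
            V.count 4 < (Z ++ 0 :: (List.replicate k 4 ++ [0])).count 4))}) := by
  obtain ⟨lZ, hlZ, hpos⟩ := ElimAlpha.exists_idx (Z ++ [0]) (by simp) 0
  obtain ⟨u', hu', hcu⟩ : ∃ u' : Fin 4, u' ≠ 0 ∧ Fin.castSucc u' = u := by
    rcases hu with rfl | rfl | rfl
    exacts [⟨1, by decide, by decide⟩, ⟨2, by decide, by decide⟩, ⟨3, by decide, by decide⟩]
  exact ElimAlpha.alpha_core lZ Z hlZ hpos k hk u' hu' (hcu ▸ huZ) hW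

end Summit.KontsevichZagierPeriods.OctahedralSymmetry.OctaSpan

end
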